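import Mathlib.NumberTheory.Bertrand
import Literature.Computability.Complexity.ShenRefereeVerdict
import Literature.Computability.Complexity.IrreducibilityLLLPrimeSearchFP
import Literature.Computability.Complexity.SumcheckMAReferee
import Literature.Computability.Complexity.LengthCompare
import HarnessLib

/-!
# The `IP = PSPACE` referee, machine layer IV: the parameters, the prime, and the referee language in `P`

Last machine file of the referee of the Shamir–Shen game for `TQBF` (Arora–Barak §8.3.3). It fixes the
parameters of the protocol as polynomial-time functions of the formula — the number of rounds
`T = N(N+1) + N`, the degree bound `d = max 2 (size φ)`, and the prime `p` of the field `𝔽_p` — and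
packages Arthur's verdict as a LANGUAGE on the game strings `⟨x, enc history⟩` of `ArthurMerlinGames.lean`:

* `ShenRef.primeAbove B` — the least prime in `(B, 2B+2]` (Bertrand's postulate,
  `Nat.exists_prime_lt_and_le_two_mul`; `primeAbove_prime`, `lt_primeAbove`, `primeAbove_le`), found by
  the tree's trial division `LLLFactoring.isPrimeTD` / `isPrimeTDC` (`IrreducibilityLLLPrimeSearch(FP).lean`), and
  `primeAboveC` (unary in, unary out; AB: "The verifier can check that `p` is prime" — here the
  verifier finds `p` itself, of `O(log n)` bits);
* the parameters `Tof`, `dOf`, `Bof = 6·T·d + 6`, `pOf = primeAbove Bof` (so `p > 6Td`, the bound that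
  makes the soundness error `T·d·(1/p + 2^{-m}) ≤ 1/3`), their polynomial bounds in the code length,
  and `ShenRef.core ψ h = natAccepts p p d ψ h` (block width `β = p`, so `p ≤ 2^β`) with **`coreC`**;
* **`ShenRef.RefLang`** — the referee language: `z` is accepted iff `fstF z` is the code of a CLOSED
  prenex formula `ψ` (`TQBFEval.validFn`, `TQBFCodewords.lean`) and `core ψ` accepts the history
  decoded from the rest; `boolPair_encode_listE_mem_RefLang_iff`, `boolPair_mem_RefLang` (invalid
  inputs are never accepted), and **`RefLang_mem_P`**.

All proved; no named facts.

## References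

* S. Arora, B. Barak, *Computational Complexity: A Modern Approach*, CUP 2009, §8.3.2 ("The verifier
  can check that `p` is prime"), §8.3.3, §1.3; Thm. 4.13 / Def. 4.10 (`TQBF`, closed formulas).
* P. L. Chebyshev / Bertrand's postulate, via Mathlib `Nat.exists_prime_lt_and_le_two_mul`.
-/

noncomputable section

namespace Literature.Computability.Complexity

open _root_.Computability Polynomial Brick CodeFP Literature.Barriers.QuantumAdvantage

namespace ShenRef

/-! ### A prime above a bound -/

/-- **A prime above `B`**: the first `n ∈ [0, 2B+3)` with `B < n` passing trial division (`0` if none —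
never, by Bertrand's postulate). [folklore] -/
def primeAbove (B : ℕ) : ℕ :=
  ((List.range (2 * B + 3)).find? fun n => decide (B < n) && LLLFactoring.isPrimeTD n).getD 0

/-- The search succeeds: Bertrand's postulate gives a prime in `(B+1, 2B+2]`. [folklore] -/
theorem primeAbove_spec (B : ℕ) : (primeAbove B).Prime ∧ B < primeAbove B ∧ primeAbove B ≤ 2 * B + 2 := by
  unfold primeAbove
  cases h : (List.range (2 * B + 3)).find? (fun n => decide (B < n) && LLLFactoring.isPrimeTD n) with
  | none =>
    exfalso
    obtain ⟨p, hp, hlt, hle⟩ := Nat.exists_prime_lt_and_le_two_mul (B + 1) (Nat.succ_ne_zero _)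
    rw [List.find?_eq_none] at h
    have := h p (List.mem_range.2 (by omega))
    simp only [Bool.and_eq_true, decide_eq_true_eq, (LLLFactoring.isPrimeTD_iff p).2 hp, and_true] at this
    omega
  | some p =>
    have hp := List.find?_some h
    have hmem := List.mem_of_find?_eq_some h
    rw [Bool.and_eq_true, decide_eq_true_eq, LLLFactoring.isPrimeTD_iff] at hp
    rw [List.mem_range] at hmem
    simp only [Option.getD_some]
    exact ⟨hp.2, hp.1, by omega⟩

/-- `primeAbove B` is prime. [folklore] -/
theorem primeAbove_prime (B : ℕ) : (primeAbove B).Prime := (primeAbove_spec B).1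

/-- `B < primeAbove B`. [folklore] -/
theorem lt_primeAbove (B : ℕ) : B < primeAbove B := (primeAbove_spec B).2.1

/-- `primeAbove B ≤ 2B + 2`. [folklore] -/
theorem primeAbove_le (B : ℕ) : primeAbove B ≤ 2 * B + 2 := (primeAbove_spec B).2.2

/-- **The prime search on codes** (unary in, unary out). [cite: AroraBarakCC2009, §1.3] -/
theorem primeAboveC : CodeFP unE unE primeAbove := by
  have hpred : CodeFP (pairE unE unE) bitE (fun t => decide (t.1 < t.2) && LLLFactoring.isPrimeTD t.2) := by
    have h1 : CodeFP (pairE unE unE) bitE (fun t => decide (t.1 < t.2)) :=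
      (natLt.comp ((natOfUn.comp (fst _ _)).pair (natOfUn.comp (snd _ _))) :)
    exact h1.and (LLLFactoring.isPrimeTDC.comp (snd _ _))
  have hrange : CodeFP unE (rawE unE) (fun B => List.range (2 * B + 3)) := by
    have h2 : CodeFP unE unE (fun B => 2 * B) := unMulConst 2
    have h3 : CodeFP unE unE (fun B => 2 * B + 3) := (unAdd.comp (h2.pair (const _ 3)) :)
    exact (LLLFactoring.urangeUn.comp h3 :)
  have hfind : CodeFP unE (optE unE) (fun B => (List.range (2 * B + 3)).find? fun n => decide (B < n) && LLLFactoring.isPrimeTD n) :=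
    ((rawFind? hpred).comp ((CodeFP.id _).pair hrange) :)
  have hget' : CodeFP (optE unE) unE (fun o : Option ℕ => o.toList.headD 0) :=
    ((rawHeadD unE (d := (0 : ℕ)) rfl).comp (optToList unE) :)
  have hget : CodeFP (optE unE) unE (fun o : Option ℕ => o.getD 0) := hget'.congr fun o => by cases o <;> rfl
  exact ((hget.comp hfind).congr fun _ => rfl :)

/-! ### The parameters of the protocol -/

/-- The number of rounds `T = N(N+1) + N`. [cite: AroraBarakCC2009, §8.3.3 ("The size of the expression is O(n²)")] -/
def Tof (ψ : PrenexQBF) : ℕ := ψ.quants.length * (ψ.quants.length + 1) + ψ.quants.length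

/-- The degree bound `d = max 2 (size φ)`. [cite: AroraBarakCC2009, §8.3.3] -/
def dOf (ψ : PrenexQBF) : ℕ := TQBFShen.degBound ψ

/-- The bound the prime has to exceed: `6·T·d + 6`. [cite: AroraBarakCC2009, §8.3.3 (soundness error `≤ n·d/p`)] -/
def Bof (ψ : PrenexQBF) : ℕ := 6 * (Tof ψ * dOf ψ) + 6

/-- **The prime of the protocol.** [cite: AroraBarakCC2009, §8.3.2 (the field `𝔽_p`)] -/
def pOf (ψ : PrenexQBF) : ℕ := primeAbove (Bof ψ)

/-- `pOf ψ` is prime. [folklore] -/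
theorem pOf_prime (ψ : PrenexQBF) : (pOf ψ).Prime := primeAbove_prime _

/-- `6·T·d + 6 < p`. [folklore] -/
theorem Bof_lt_pOf (ψ : PrenexQBF) : Bof ψ < pOf ψ := lt_primeAbove _

/-- `p ≤ 2(6·T·d + 6) + 2`. [folklore] -/
theorem pOf_le (ψ : PrenexQBF) : pOf ψ ≤ 2 * Bof ψ + 2 := primeAbove_le _

/-- `T = |ops ψ|`. [folklore] -/
theorem Tof_eq (ψ : PrenexQBF) : Tof ψ = (TQBFShen.ops ψ).length := (TQBFShen.length_ops ψ).symm

/-- `N ≤ |code ψ|`. [folklore] -/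
theorem quants_length_le (ψ : PrenexQBF) : ψ.quants.length ≤ (qbfE ψ).length := by
  have h : (qbfE ψ).length = 2 * ψ.quants.length + 2 + (pfE ψ.matrix).length := by rw [qbfE_apply, length_boolPair]
  omega

/-- `size φ ≤ |code ψ|`. [folklore] -/
theorem matrix_size_le (ψ : PrenexQBF) : ψ.matrix.size ≤ (qbfE ψ).length := by
  have h : (qbfE ψ).length = 2 * ψ.quants.length + 2 + (2 * (unaryEncodeNat ψ.matrix.size).length + 2 + ψ.matrix.code.length) := by
    rw [qbfE_apply, length_boolPair, pfE_apply, length_boolPair]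
  have : (unaryEncodeNat ψ.matrix.size).length = ψ.matrix.size := length_unE _
  omega

/-- `d ≤ |code ψ| + 2`. [folklore] -/
theorem dOf_le (ψ : PrenexQBF) : dOf ψ ≤ (qbfE ψ).length + 2 := by
  unfold dOf TQBFShen.degBound; have := matrix_size_le ψ; omega

/-- `T ≤ |code ψ|² + 2|code ψ|`. [folklore] -/
theorem Tof_le (ψ : PrenexQBF) : Tof ψ ≤ (qbfE ψ).length * (qbfE ψ).length + 2 * (qbfE ψ).length := by
  unfold Tof; have := quants_length_le ψ; nlinarith

/-- `6·T·d + 6 ≤ 6(n² + 2n)(n + 2) + 6`, `n = |code ψ|`. [folklore] -/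
theorem Bof_le (ψ : PrenexQBF) :
    Bof ψ ≤ 6 * (((qbfE ψ).length * (qbfE ψ).length + 2 * (qbfE ψ).length) * ((qbfE ψ).length + 2)) + 6 := by
  unfold Bof; exact Nat.add_le_add_right (Nat.mul_le_mul_left _ (Nat.mul_le_mul (Tof_le ψ) (dOf_le ψ))) _

/-- **The referee core**: Arthur's verdict with the protocol's parameters — modulus `p`, block width
`β = p` (so that a block holds a residue, `p ≤ 2^p`), degree bound `d`. [cite: AroraBarakCC2009, §8.3.3] -/
def core (ψ : PrenexQBF) (h : List (List Bool)) : Bool :=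
  natAccepts (pOf ψ) (pOf ψ) (dOf ψ) ψ h

/-- A unary polynomial of the length of the code. [cite: AroraBarakCC2009, §1.3] -/
theorem polyLenU (Q : Polynomial ℕ) : CodeFP qbfE unE (fun ψ => Q.eval (qbfE ψ).length) :=
  of_fn (Plumb.polyFn Q) (Plumb.polyFn_mem_FP Q) fun ψ => by rw [Plumb.polyFn_apply, unE_eq_ones]

/-- The size of the matrix, in unary, on codes. [folklore] -/
theorem matrixSizeC : CodeFP qbfE unE (fun ψ => ψ.matrix.size) :=
  of_fn (fstF ∘ sndF) (comp_mem_FP fstF_mem_FP sndF_mem_FP) fun ψ => by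
    rw [Function.comp_apply, qbfE_apply, sndF_boolPair, pfE_apply, fstF_boolPair]

/-- The degree bound, in unary, on codes. [folklore] -/
theorem dOfC : CodeFP qbfE unE dOf := by
  have hnat : CodeFP qbfE natE (fun ψ => max 2 ψ.matrix.size) := (natMax.comp ((const _ 2).pair (natOfUn.comp matrixSizeC)) :)
  have hmin : CodeFP qbfE unE (fun ψ => min (max 2 ψ.matrix.size) ((X + 2 : Polynomial ℕ).eval (qbfE ψ).length)) :=
    (unOfNatMin.comp ((polyLenU (X + 2)).pair hnat) :)
  exact hmin.congr fun ψ => by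
    have h := dOf_le ψ
    unfold dOf TQBFShen.degBound at h ⊢
    rw [min_eq_left]
    simpa using h

/-- The number of rounds, in binary, on codes. [folklore] -/
theorem TofC : CodeFP qbfE natE Tof := by
  have hN : CodeFP qbfE natE (fun ψ => ψ.quants.length) := (strNatLength.comp quantsC :)
  have hN1 : CodeFP qbfE natE (fun ψ => ψ.quants.length + 1) := (natAdd.comp (hN.pair (const _ 1)) :)
  have hM : CodeFP qbfE natE (fun ψ => ψ.quants.length * (ψ.quants.length + 1)) := (natMul.comp (hN.pair hN1) :)
  exact ((natAdd.comp (hM.pair hN)).congr fun _ => rfl :)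

/-- The prime bound, in unary, on codes. [folklore] -/
theorem BofC : CodeFP qbfE unE Bof := by
  have hTd : CodeFP qbfE natE (fun ψ => Tof ψ * dOf ψ) := (natMul.comp (TofC.pair (natOfUn.comp dOfC)) :)
  have h6 : CodeFP qbfE natE (fun ψ => 6 * (Tof ψ * dOf ψ)) := (natMul.comp ((const _ 6).pair hTd) :)
  have hB : CodeFP qbfE natE (fun ψ => 6 * (Tof ψ * dOf ψ) + 6) := (natAdd.comp (h6.pair (const _ 6)) :)
  have hmin : CodeFP qbfE unE (fun ψ => min (6 * (Tof ψ * dOf ψ) + 6)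
      ((6 * ((X * X + 2 * X) * (X + 2)) + 6 : Polynomial ℕ).eval (qbfE ψ).length)) :=
    (unOfNatMin.comp ((polyLenU (6 * ((X * X + 2 * X) * (X + 2)) + 6)).pair hB) :)
  exact hmin.congr fun ψ => by
    have h := Bof_le ψ
    unfold Bof at h ⊢
    rw [min_eq_left]
    simpa using h

/-- The prime, in unary, on codes. [folklore] -/
theorem pOfC : CodeFP qbfE unE pOf := (primeAboveC.comp BofC :)

/-- **The referee core on codes**: `(ψ, h) ↦ core ψ h`. [cite: AroraBarakCC2009, §8.3.3 (polynomial-time verifier)] -/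
theorem coreC : CodeFP (pairE qbfE (rawE strE)) bitE (fun t => core t.1 t.2) := by
  have hψ : CodeFP (pairE qbfE (rawE strE)) qbfE (fun t => t.1) := fst _ _
  have hparams : CodeFP (pairE qbfE (rawE strE)) (pairE natE (pairE unE unE)) (fun t => (pOf t.1, pOf t.1, dOf t.1)) :=
    ((natOfUn.comp (pOfC.comp hψ)).pair ((pOfC.comp hψ).pair (dOfC.comp hψ)) :)
  have h := natAcceptsC.comp (hparams.pair (CodeFP.id _))
  exact h.congr fun t => by
    show natAccepts (max (pOf t.1) 2) (pOf t.1) (dOf t.1) t.1 t.2 = core t.1 t.2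
    rw [max_eq_left (pOf_prime t.1).two_le]
    rfl

/-! ### The referee language -/

/-- **The referee language of the `TQBF` game**: `z` is accepted iff `fstF z` is the code of a closed prenex
formula `ψ` and Arthur's verdict on the history decoded from the rest of `z` (total decoding of the list
code after the unary header of the game string) is `accept`. [cite: AroraBarakCC2009, §8.3.3] -/
def RefLang : Language Bool :=
  {z | ∃ ψ : PrenexQBF, ψ.IsClosed ∧ ψ.encode = fstF z ∧ core ψ (decNil (sndF (sndF z))) = true}

/-- On a game string `⟨code ψ, enc h⟩` with `ψ` closed, the referee runs `core ψ h`. [folklore] -/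
theorem boolPair_encode_listE_mem_RefLang_iff {ψ : PrenexQBF} (hψ : ψ.IsClosed) (h : List (List Bool)) :
    boolPair ψ.encode ((encodingList Bool).listBool.encode h) ∈ RefLang ↔ core ψ h = true := by
  have hdec : decNil (sndF (sndF (boolPair ψ.encode ((encodingList Bool).listBool.encode h)))) = h := by
    rw [show ((encodingList Bool).listBool.encode h : List Bool) = listE strE h from congrFun (listE_eq (encodingList Bool)) h,
      sndF_boolPair, listE, sndF_boolPair, decNil_rawE, List.map_id]
  constructor
  · rintro ⟨ψ', -, hcode, hcore⟩
    rw [fstF_boolPair] at hcode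
    rw [PrenexQBF.encode_injective hcode] at hcore
    rwa [hdec] at hcore
  · intro hc
    exact ⟨ψ, hψ, by rw [fstF_boolPair], by rw [hdec]; exact hc⟩

/-- A string whose first component is not the code of a closed formula is never accepted. [folklore] -/
theorem boolPair_mem_RefLang {x w : List Bool} (hz : boolPair x w ∈ RefLang) : ∃ ψ : PrenexQBF, ψ.IsClosed ∧ ψ.encode = x := by
  obtain ⟨ψ, hψ, hcode, -⟩ := hz
  rw [fstF_boolPair] at hcode
  exact ⟨ψ, hψ, hcode⟩

/-- **The referee is polynomial time**: some `F ∈ FP` computes `z ↦ [z ∈ RefLang]` — test validity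
(`TQBFEval.validFn`), canonicalise the history code (`SumcheckMA.decNilC`), and run `coreC`.
[cite: AroraBarakCC2009, §8.3.3 (polynomial-time verifier)] -/
theorem exists_refFn : ∃ F ∈ FP, ∀ z : List Bool, (z ∈ RefLang → F z = [true]) ∧ (z ∉ RefLang → F z = [false]) := by
  classical
  obtain ⟨Cf, hCf, hCfs⟩ := coreC
  obtain ⟨Df, hDf, hDfs⟩ := SumcheckMA.decNilC
  have hDfs' : ∀ w : List Bool, Df w = rawE strE (decNil w) := hDfs
  have hCfs' : ∀ (ψ : PrenexQBF) (h : List (List Bool)), Cf (boolPair (qbfE ψ) (rawE strE h)) = [core ψ h] := fun ψ h => hCfs (ψ, h)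
  have hbuild : (fanoutFn fstF (Df ∘ sndF ∘ sndF) : List Bool → List Bool) ∈ FP :=
    fanoutFn_mem_FP fstF_mem_FP (comp_mem_FP hDf (comp_mem_FP sndF_mem_FP sndF_mem_FP))
  refine ⟨iteFn (TQBFEval.validFn ∘ fstF) (Cf ∘ fanoutFn fstF (Df ∘ sndF ∘ sndF)) (fun _ => [false]),
    iteFn_mem_FP (comp_mem_FP TQBFEval.validFn_mem_FP fstF_mem_FP) (comp_mem_FP hCf hbuild) (const_mem_FP _), fun z => ?_⟩
  rw [iteFn_of_oneBit (TQBFEval.oneBit_validFn.comp _)]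
  by_cases hv : (TQBFEval.validFn ∘ fstF) z = [true]
  · obtain ⟨ψ, hcode, hψ⟩ := TQBFEval.exists_of_validFn_eq_true hv
    have hF : (Cf ∘ fanoutFn fstF (Df ∘ sndF ∘ sndF)) z = [core ψ (decNil (sndF (sndF z)))] := by
      simp only [Function.comp_apply, fanoutFn_apply, hDfs', ← hcode]
      exact hCfs' ψ _
    have hmem : z ∈ RefLang ↔ core ψ (decNil (sndF (sndF z))) = true := by
      constructor
      · rintro ⟨ψ', -, hcode', hcore⟩
        rw [← hcode] at hcode'
        rwa [PrenexQBF.encode_injective hcode'] at hcore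
      · exact fun hc => ⟨ψ, hψ, hcode, hc⟩
    rw [if_pos hv, hF]
    refine ⟨fun hz => by rw [hmem.1 hz], fun hz => ?_⟩
    rw [hmem, Bool.not_eq_true] at hz
    rw [hz]
  · rw [if_neg hv]
    refine ⟨fun hz => absurd ?_ hv, fun _ => rfl⟩
    obtain ⟨ψ, hψ, hcode, -⟩ := hz
    rw [Function.comp_apply, ← hcode, TQBFEval.validFn_encode, decide_eq_true hψ]

/-- **The referee language is in `P`.** [cite: AroraBarakCC2009, §8.3.3 (polynomial-time verifier)] -/
theorem RefLang_mem_P : RefLang ∈ Classes.P := by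
  obtain ⟨F, hF, hFz⟩ := exists_refFn
  exact mem_P_of_mem_FP hF RefLang hFz

end ShenRef

end Literature.Computability.Complexity

end
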